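import Literature.Analysis.FluidPDE.EulerReynolds
import Literature.Analysis.FunctionSpaces.HolderNorm
import HarnessLib

/-!
# Classical solutions of the Euler equations on `T³`: short-time existence and propagation of
Hölder norms (named facts)

Analysis/FluidPDE fact file. The local existence theorem for the incompressible Euler equations
in Hölder spaces on the three-torus, in the form quoted by Buckmaster–De Lellis–Székelyhidi–Vicol
(BDSV 2019, Prop. 3.1 = the named fact `BDSV.localEulerHolder` of `OnsagerBDSVGluing.lean`:
smooth data `u₀`, life span `T ≤ c(α)‖u₀‖_{1+α}⁻¹`, uniqueness, and the bounds
`‖u‖_{N+α} ≲ ‖u₀‖_{N+α}`, `N ≥ 1`), is proved in the literature in two steps, which BDSV separate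
explicitly ("The proof of the existence of a unique solution is standard (see e.g. [MaBe2002])
… The higher-order bounds are also standard, and can be obtained as follows: …
[commuting `∂^θ` with the equation, Schauder estimates for `∇∂^θp`, the transport estimate (B.1)
and Grönwall's inequality]"):

* **short-time existence of a smooth solution for smooth data**, with a life span controlled by
  a *high* norm of the datum — the energy method in Sobolev spaces `H^m`, `m ≥ ⌊d/2⌋ + 2`
  (Majda–Bertozzi 2002, Thm. 3.4: "there exists a time `T` with the rough upper bound
  `T ≤ 1/(c_m‖v₀‖_m)` such that … there exists the unique solution …", with (3.56)
  `sup_{[0,T]} ‖v‖_m ≤ ‖v₀‖_m/(1 - c_mT‖v₀‖_m)`; stated on `ℝ³`, the periodic case being covered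
  by the same Fourier/energy arguments, cf. MB §1.1 (1.8) and §1.9; smoothness of the solution
  for `C^∞` data: Bardos–Frisch 1976, Prop. 1, "if `u₀ ∈ C^∞`, then `u(t)` remains in `C^∞` on the
  whole interval `]-T*, T*[`");
* **a priori propagation of Hölder norms** along any smooth solution for times
  `|t| ≤ c(α)‖u₀‖_{1+α}⁻¹`: `‖u(t)‖_{1+α} ≤ 2‖u₀‖_{1+α}` (the Riccati-type `C^{1,α}` estimate,
  Bardos–Frisch 1976, Thm. 1 (5): `‖u(t)‖_{1,α} ≤ ‖u₀‖_{1,α} T*/(T* - |t|)`, `T* = (C₁‖u₀‖_{1,α})⁻¹`)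
  and `‖u(t)‖_{N+α} ≤ C_N ‖u₀‖_{N+α}` for `N ≥ 2` (linear Grönwall; BDSV Prop. 3.1, proof, and
  Bardos–Frisch 1976, Prop. 1).

From these two facts and the (proved) uniqueness of smooth solutions, `BDSV.localEulerHolder`
follows by the classical continuation argument (restart the short-time solution from `u(t)`,
whose `C⁴` norm is a priori bounded on `[-T, T]`, in finitely many steps of fixed length, and glue
by uniqueness); that assembly is `OnsagerBDSVLocalEulerProofs.lean`. This file only states the
two facts, as `Prop`s (D-0014), in the vocabulary of the tree:

* solutions are `Torus.IsEulerReynoldsOn S u p 0` (`EulerReynolds.lean`: jointly smooth on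
  `S × T³`, `∂ₜu + (u·∇)u + ∇p = 0` with the one-sided time derivative within `S`, `div u = 0`,
  mean-zero pressure), i.e. `BDSV.IsExactEulerOn S u p`;
* norms are the accepted `Torus.eContDiffHolderNorm N r` (`‖·‖_{C^{N,r}(T³)}` of the periodic
  lift, `HolderNorm.lean`), with `r = α` resp. `r = 0` (the `C⁴` norm in the life span of the
  first fact; `‖v₀‖_{H⁴(T³)} ≤ C‖v₀‖_{C⁴(T³)}` on the unit-volume torus, so this is the case `m = 4`
  of MB Thm. 3.4), and bounds are hypotheses `‖f‖ ≤ K` with real `K` (the norms are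
  `ℝ≥0∞`-valued), exactly as in `BDSV.localEulerHolder`.

## Main statements (named facts, nothing asserted)

* `Torus.eulerSmoothShortTime`: there is `c > 0` such that every smooth divergence-free `u₀` on
  `T³` with `‖u₀‖_{C⁴} ≤ M`, `M > 0`, is the initial value of a smooth solution `(u, p)` of the
  Euler equations on `[-c/M, c/M] × T³`.
* `Torus.eulerHolderPropagation`: for `0 < α < 1` there are `c > 0` and constants `C_N` such that
  every smooth solution on a time interval `[a, b] ∋ 0` contained in `[-T, T]`, with
  `‖u(0)‖_{1+α} ≤ K` and `T K ≤ c`, satisfies `‖u(t)‖_{N+α} ≤ C_N K_N` on `[a, b]` whenever `N ≥ 1`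
  and `‖u(0)‖_{N+α} ≤ K_N`.

## Design choices

* Both facts are stated two-sided in time (the Euler equations are time-reversible,
  `(u, p)(t) ↦ (-u, p)(-t)`; Bardos–Frisch state their results on `]-T*, T*[`, BDSV on `[-T, T]`),
  and the second for an arbitrary compact interval `[a, b] ∋ 0` inside `[-T, T]` (it is an
  a priori estimate: the bound at time `t` only involves the solution between `0` and `t`), which
  is the form consumed by the continuation argument.
* The life span of the first fact is governed by the `C⁴` norm (any fixed high norm would do for
  the assembly; `m = 4` is the smallest order for which the `H^m` energy estimate on `T³` closes
  with the embedding `H² ⊂ L^∞` alone). Its threshold `c` is absolute (dimension `3` is fixed).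
* Dimension three only (`UnitAddTorus (Fin 3)`), as in the consumer; nothing here is specific to
  BDSV's convex-integration scheme.

## Mathlib / tree search

Mathlib has no existence theory for Euler or Navier–Stokes. Tree: `lean search 'localEuler|
shortTime|local existence'` — `BDSV.localEulerHolder` (the consumer, T³, named fact),
`MajdaBertozzi2002_holderEulerLocalExistence` (`ElgindiBlowupContinuationProofs.lean`: whole
space `ℝ³`, `C^{1,γ}` with compactly supported vorticity, MB Thm. 4.2) and
`KatoLai1984_periodicCylinderSmoothExistence` (`KatoLaiPeriodicCylinder.lean`: periodic cylinder
with boundary, Kato–Lai 1984); none covers the flat three-torus.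

## References

* A. J. Majda, A. L. Bertozzi, *Vorticity and Incompressible Flow*, CUP 2002: §3.2, Thm. 3.4
  (i)–(ii) with (3.55)–(3.56), Thm. 3.5, Cor. 3.1 (uniqueness), Cor. 3.2; §1.1 (1.8) (periodic
  flows). [`MajdaBertozziCUP2002`]
* C. Bardos, U. Frisch, *Finite-time regularity for bounded and unbounded ideal incompressible
  fluids using Hölder estimates*, in: Turbulence and Navier–Stokes equations, LNM 565 (1976)
  1–13: Thm. 1 with (5), Thm. 2 with (7), Prop. 1, Remark 1 (any dimension). [`BardosFrisch1976`]
* T. Buckmaster, C. De Lellis, L. Székelyhidi Jr., V. Vicol, *Onsager's conjecture for admissible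
  weak solutions*, CPAM 72 (2019) = arXiv:1701.08678: Prop. 3.1 and its proof, (3.2); App. A
  (Hölder norms), App. B Prop. B.1 (transport estimates), App. C Prop. C.1 (Calderón–Zygmund on
  `C^α(T³)`). [`BuckmasterEtAl2018`]
-/

open MeasureTheory Set
open scoped NNReal ENNReal ContDiff

noncomputable section

namespace Literature.Analysis.FluidPDE

namespace Torus

/-- The flat three-torus `T³ = (ℝ/ℤ)³`, local notation. -/
local notation "𝕋³" => UnitAddTorus (Fin 3)

/-- Euclidean `ℝ³`, local notation. -/
local notation "ℝ³" => EuclideanSpace ℝ (Fin 3)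

/-- **Short-time existence of smooth solutions of the Euler equations on `T³`** (the energy
method in `H^m`, Majda–Bertozzi 2002, Thm. 3.4 (i)–(ii): "Given an initial condition `v₀ ∈ V^m`,
`m ≥ ⌊N/2⌋ + 2`, … there exists a time `T` with the rough upper bound `T ≤ 1/(c_m‖v₀‖_m)` such
that … there exists the unique solution … to the Euler or the Navier–Stokes equation", with
`sup_{0≤t≤T} ‖v‖_m ≤ ‖v₀‖_m/(1 - c_m T‖v₀‖_m)` (3.56); periodic flows `x ∈ T^N` as in §1.1 (1.8);
for `C^∞` data the solution is `C^∞` on the same interval, Bardos–Frisch 1976, Prop. 1). Rendered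
for `m = 4` on the unit three-torus, where `‖v₀‖_{H⁴} ≤ C‖v₀‖_{C⁴}`, two-sided in time (time
reversibility), and for smooth data: there is an absolute constant `c > 0` such that for every
smooth divergence-free `u₀ : T³ → ℝ³` and every `M > 0` with `‖u₀‖_{C⁴(T³)} ≤ M`
(`Torus.eContDiffHolderNorm 4 0`) there is a smooth solution `(u, p)` of the Euler equations on
`[-c/M, c/M] × T³` — an Euler–Reynolds triple with zero stress, `Torus.IsEulerReynoldsOn`, i.e.
jointly smooth, `∂ₜu + (u·∇)u + ∇p = 0`, `div u = 0`, `∫ p(t) = 0` — with `u(0) = u₀`. (This is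
also the existence clause of BDSV Prop. 3.1 for any fixed `α`, since `‖u₀‖_{1+α} ≤ 27‖u₀‖_{C⁴}`
for the norms of the tree; it is separated from the Hölder bounds because its proof is the
Sobolev energy method.) [cite: MajdaBertozziCUP2002, Thm. 3.4 (i)-(ii), (3.55)-(3.56)] -/
def eulerSmoothShortTime : Prop :=
  ∃ c : ℝ, 0 < c ∧
    ∀ u₀ : 𝕋³ → ℝ³, FunctionSpaces.Torus.IsSmooth u₀ → FunctionSpaces.Torus.IsDivFree u₀ →
      ∀ M : ℝ, 0 < M →
        FunctionSpaces.Torus.eContDiffHolderNorm 4 0 u₀ ≤ ENNReal.ofReal M →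
          ∃ (u : ℝ → 𝕋³ → ℝ³) (p : ℝ → 𝕋³ → ℝ),
            IsEulerReynoldsOn (Icc (-(c / M)) (c / M)) u p (fun _ _ _ => 0) ∧ u 0 = u₀

/-- **A priori propagation of Hölder norms for smooth Euler solutions on `T³`** (the bounds
`‖u‖_{N+α} ≲ ‖u₀‖_{N+α}`, `N ≥ 1`, of BDSV Prop. 3.1, (3.2), for times `|t| ≤ T`,
`T ≤ c(α)‖u₀‖_{1+α}⁻¹`, in the a priori form in which they are proved there: "For any multi-index
`θ` with `|θ| = N` we have `∂ₜ∂^θv + v·∇∂^θv + [∂^θ, v·∇]v + ∇∂^θp = 0`. Using the equation for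
the pressure `-Δp = ∇v·∇v` and Schauder estimates … `‖(∂ₜ + v·∇)∂^θv‖_α ≲ ‖v‖_{1+α}‖v‖_{N+α}`, and
(3.2) follows by applying (B.1) and Grönwall's inequality"; the case `N = 1` is the classical
`C^{1,α}` estimate of Bardos–Frisch 1976, Thm. 1 (5), `‖u(t)‖_{1,α} ≤ ‖u₀‖_{1,α} T*/(T* - |t|)`
with `T* = (C₁‖u₀‖_{1,α})⁻¹`, and the persistence of `C^{k,α}` regularity is their Prop. 1).
Transcription: for `0 < α < 1` there are `c > 0` and constants `C_N` such that for all `T` and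
every smooth solution `(u, p)` of the Euler equations (`Torus.IsEulerReynoldsOn` with zero
stress) on a nondegenerate time interval `[a, b]` with `-T ≤ a ≤ 0 ≤ b ≤ T`, every `K ≥ 0` with
`‖u(0)‖_{1+α} ≤ K` and `T K ≤ c`: whenever `N ≥ 1`, `K' ≥ 0` and `‖u(0)‖_{N+α} ≤ K'`, then
`‖u(t)‖_{N+α} ≤ C_N K'` for all `t ∈ [a, b]`; norms are the accepted
`Torus.eContDiffHolderNorm N α` (BDSV App. A, equivalent up to constants depending on `N`).
[cite: BuckmasterEtAl2018, Prop. 3.1, (3.2) and proof] -/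
def eulerHolderPropagation : Prop :=
  ∀ α : ℝ, 0 < α → α < 1 → ∃ c : ℝ, 0 < c ∧ ∃ C : ℕ → ℝ,
    ∀ (T a b : ℝ) (u : ℝ → 𝕋³ → ℝ³) (p : ℝ → 𝕋³ → ℝ),
      a < b → -T ≤ a → a ≤ 0 → 0 ≤ b → b ≤ T →
      IsEulerReynoldsOn (Icc a b) u p (fun _ _ _ => 0) →
        ∀ K : ℝ, 0 ≤ K →
          FunctionSpaces.Torus.eContDiffHolderNorm 1 (Real.toNNReal α) (u 0) ≤ ENNReal.ofReal K →
          T * K ≤ c →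
            ∀ N : ℕ, 1 ≤ N → ∀ K' : ℝ, 0 ≤ K' →
              FunctionSpaces.Torus.eContDiffHolderNorm N (Real.toNNReal α) (u 0) ≤
                ENNReal.ofReal K' →
                ∀ t ∈ Icc a b,
                  FunctionSpaces.Torus.eContDiffHolderNorm N (Real.toNNReal α) (u t) ≤
                    ENNReal.ofReal (C N * K')

end Torus

end Literature.Analysis.FluidPDE
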